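import Literature.AnabelianGeometry.SemiGraphs.InducedAlongInheritance
import Literature.AnabelianGeometry.SemiGraphs.SgALocalizations
import Literature.AnabelianGeometry.SemiGraphs.AmbientArrowClassesLaws

/-!
# Full-star sub-semi-graphs and the carrier of "the link contained in a covering" ([SemiAnbd] §1 p.12, §4 Prop 4.7 p.57)

Mochizuki, *Semi-graphs of anabelioids*, Publ. RIMS **42** (2006), §1 p.12 (sub-semi-graphs: "a branch
abuts, relative to `H`, to `v` iff it abuts to `v` relative to `G` and `v` lies in `H`"), p.13 (immersions,
excisions), §4 p.50, opening discussion before Def 4.1 (`𝒢_H` "obtained by pulling back the semi-graph of anabelioids structure of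
`𝒢`"), Def 4.2 (i) p.52 (links: open objects of verticial length `2`, edge-wise length `1`), Rmk 4.2.1
p.52 ("the 'local surjectivity' of branches follows from the verticial iso-excisiveness of the local
`(𝒢, Γ)`-structures involved" — a finite open object of `Loc(𝔾, Γ)` carries at each vertex the FULL star of
its image in an untangled covering) and the proof of Prop 4.7 p.57 ("if we take `H₃` to be the link
contained in `𝒢₃` which is determined by the images `v₃`, `e₃` of `v′`, `e′` …"; print's calligraphic `𝒢₃` is a
semi-graph of anabelioids, the cell's `𝔾₃` below denotes its underlying semi-graph) (kurims
`paper:url-f33ace170ff4`). [cite: MochizukiSemiAnbd2006, §1, p. 12]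

DEFINITIONS (cell abc-iut, layer L3, seat abc-iut-L3-t12 gen 10; brick B1 of the L3 lead's successor row
«PROP47@REAL-CONSTRUCTION», item (γ) «link-in-a-covering constructor», SHAPES memo
`HOME/staging/L3/L3-t12/g10/SHAPES-gamma-LinkInCovering.md`): over abc-iut-L3-t1's `SemiGraph` /
`SemiGraph.Subgraph` (`SemiGraph.lean`) and the pull-back `SemiGraphOfAnabelioids.inducedAlong`
(`InducedAlong.lean`, abc-iut-L3-t3 lineage):

* `SemiGraph.starSubgraph G S` — the FULL-STAR sub-semi-graph of `G` on a set `S` of vertices: vertices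
  `S`, edges all edges of `G` abutting to some vertex of `S` (each with both its branches; abutments outside
  `S` forgotten, so such edges become open).  Its inclusion `ι` is an EXCISION (`starSubgraph_ι_isExcision`:
  the star of each `v ∈ S` is kept entire — the shape Rmk 4.2.1 forces on finite open objects), hence an
  immersion; it is finite when `S` is finite and `G` locally finite; every edge of it abuts to a vertex.
* `SgAQuot.SgA.starAt X S` — for an object `X` of the ambient category `SgA` (totally aloof, verticially
  slim semi-graphs of anabelioids, Rmk 2.4.2), the semi-graph of anabelioids `𝒳_{starSubgraph S}` pulled
  back along `ι` AS AN OBJECT OF `SgA` (`isAmbientObj_inducedAlong`), with its natural arrow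
  `starAtHom : X.starAt S ⟶ X` — locally trivial, lying over the excision `ι`.  For `X = 𝔾₃` an untangled
  finite étale covering of `𝔾` and `S = {v₃, v₃′}` the two abutments of a closed edge `e₃`, `X.starAt S` is
  the underlying semi-graph of anabelioids of print's "link contained in `𝒢₃` … determined by … `v₃`, `e₃`"
  when `e₃` is the unique closed edge joining `v₃`, `v₃′` (its local `(𝔾, Γ)`-structure and finite-open datum
  are the subsequent bricks B2/B3 of the memo).

v2 (doc-only, ref-e E25 F103/F104/F105: locators of "of injective type" (§2 p.22) and of the `𝒢_H` notation
(§4 p.50, before Def 4.1); print's glyphs inside quotation marks; declarations byte-identical to p504970).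
Nothing printed is asserted or discharged here (a constructor brick); no instance, no notation.  Honest
scope: the READING of "the link contained in `𝒢₃`" as a full-star sub-semi-graph is the memo's READING FLAG
(abc-iut-L3-t1's `SemiGraph.atEdge` = print's one-edge `𝔾[e]` is never a finite open object); typed ≠
proved; nothing here takes a side on [IUTchIII] Cor. 3.12.
-/

noncomputable section

namespace Literature.AnabelianGeometry.SemiGraphs

open CategoryTheory

universe v₁ u₁ u

/-! ### 1. Sub-semi-graphs: the coincidence maps of `H.toSemiGraph` -/

namespace SemiGraph

namespace Subgraph

variable {G : SemiGraph.{u}} (H : G.Subgraph)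

/-- In a sub-semi-graph, a branch abuts to `w` iff it abuts to `w` in `G` (condition (b)/(c) of §1
p.12, forward direction). [cite: MochizukiSemiAnbd2006, §1, p. 12] -/
theorem abuts_eq_some (b : H.toSemiGraph.Branch) (w : H.toSemiGraph.Vertex)
    (h : H.toSemiGraph.abuts b = some w) : G.abuts b.1 = some w.1 :=
  H.ι.abuts_branchMap b w h

/-- In a sub-semi-graph, a branch abutting in `G` to a vertex `v` of the sub-semi-graph abuts to it
(condition (b)/(c) of §1 p.12, backward direction). [cite: MochizukiSemiAnbd2006, §1, p. 12] -/
theorem abuts_eq_some_of (b : H.toSemiGraph.Branch) (v : G.Vertex) (hv : v ∈ H.verts)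
    (h : G.abuts b.1 = some v) : H.toSemiGraph.abuts b = some ⟨v, hv⟩ := by
  change (G.abuts b.1).pbind _ = _
  rw [h, Option.pbind_some]
  exact dif_pos hv

/-- In a sub-semi-graph, a branch abuts to some vertex iff it abuts in `G` to a vertex of the
sub-semi-graph. [cite: MochizukiSemiAnbd2006, §1, p. 12] -/
theorem abuts_isSome_iff (b : H.toSemiGraph.Branch) :
    (H.toSemiGraph.abuts b).isSome ↔ ∃ v ∈ H.verts, G.abuts b.1 = some v := by
  constructor
  · intro h
    obtain ⟨w, hw⟩ := Option.isSome_iff_exists.mp h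
    exact ⟨w.1, w.2, H.abuts_eq_some b w hw⟩
  · rintro ⟨v, hv, h⟩
    rw [H.abuts_eq_some_of b v hv h]
    rfl

/-- The inclusion of a sub-semi-graph is injective on the branches abutting to each vertex (an
immersion, §1 p.13). [cite: MochizukiSemiAnbd2006, §1, p. 13] -/
theorem ι_isImmersion : IsImmersion H.ι := by
  intro w x y hxy
  apply Subtype.ext
  apply Subtype.ext
  exact congrArg (fun z : G.Star w.1 => z.1) hxy

end Subgraph

/-! ### 2. The full-star sub-semi-graph on a set of vertices -/

variable (G : SemiGraph.{u})

/-- **The full-star sub-semi-graph of `G` on a set `S` of vertices**: vertices `S`, edges = all edges of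
`G` abutting to some vertex of `S` (§1 p.12; an edge whose other abutment lies outside `S` becomes an open
edge of the sub-semi-graph).  For `S = {v₃, v₃′}` the two abutments of a closed edge of an untangled
covering `𝔾₃`, this is the underlying semi-graph of "the link contained in `𝒢₃` … determined by … `v₃`, `e₃`"
(Prop 4.7, proof p.57), the shape forced by Rmk 4.2.1. [cite: MochizukiSemiAnbd2006, §1, p. 12] -/
def starSubgraph (S : Set G.Vertex) : G.Subgraph where
  verts := S
  edges := {e | ∃ v ∈ S, G.EdgeAbuts e v}

variable (S : Set G.Vertex)

/-- The vertices of the full-star sub-semi-graph are `S`. [cite: MochizukiSemiAnbd2006, §1, p. 12] -/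
@[simp] theorem starSubgraph_verts : (G.starSubgraph S).verts = S := rfl

/-- The edges of the full-star sub-semi-graph are the edges abutting to `S`. [cite: MochizukiSemiAnbd2006, §1, p. 12] -/
theorem mem_starSubgraph_edges_iff (e : G.Edge) :
    e ∈ (G.starSubgraph S).edges ↔ ∃ v ∈ S, G.EdgeAbuts e v := Iff.rfl

/-- The edge of a branch abutting to a vertex of `S` belongs to the full star.
[cite: MochizukiSemiAnbd2006, §1, p. 12] -/
theorem edgeOf_mem_starSubgraph_edges {b : G.Branch} {v : G.Vertex} (hv : v ∈ S)
    (h : G.abuts b = some v) : G.edgeOf b ∈ (G.starSubgraph S).edges :=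
  ⟨v, hv, b, rfl, h⟩

/-- **The inclusion of a full-star sub-semi-graph is an EXCISION** (bijective on the branches abutting
to each vertex, §1 pp.13–14): the whole star of every `v ∈ S` is kept — the "local surjectivity of
branches" that Rmk 4.2.1 derives from verticial iso-excisiveness for finite open objects of `Loc(𝔾, Γ)`.
[cite: MochizukiSemiAnbd2006, Rmk 4.2.1, p. 52] -/
theorem starSubgraph_ι_isExcision : IsExcision (G.starSubgraph S).ι := by
  intro w
  refine ⟨(G.starSubgraph S).ι_isImmersion w, fun c => ?_⟩
  -- every branch of `G` abutting to `w` is a branch of the star abutting to `w`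
  let b : (G.starSubgraph S).toSemiGraph.Branch := ⟨c.1, G.edgeOf_mem_starSubgraph_edges S w.2 c.2⟩
  refine ⟨⟨b, (G.starSubgraph S).abuts_eq_some_of b w.1 w.2 c.2⟩, ?_⟩
  exact Subtype.ext rfl

/-- The inclusion of a full-star sub-semi-graph is an immersion. [cite: MochizukiSemiAnbd2006, §1, p. 13] -/
theorem starSubgraph_ι_isImmersion : IsImmersion (G.starSubgraph S).ι :=
  (G.starSubgraph S).ι_isImmersion

/-- Every edge of a full-star sub-semi-graph abuts to one of its vertices (no isolated edges; the
[IUTchI] Rmk 2.5.3 (iii) hypothesis of the ambient category). [cite: MochizukiSemiAnbd2006, §1, p. 12] -/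
theorem starSubgraph_edgeAbuts (e : (G.starSubgraph S).toSemiGraph.Edge) :
    ∃ (b : (G.starSubgraph S).toSemiGraph.Branch) (w : (G.starSubgraph S).toSemiGraph.Vertex),
      (G.starSubgraph S).toSemiGraph.edgeOf b = e ∧ (G.starSubgraph S).toSemiGraph.abuts b = some w := by
  obtain ⟨v, hv, c, hce, hcv⟩ := e.2
  refine ⟨⟨c, hce ▸ e.2⟩, ⟨v, hv⟩, Subtype.ext hce, ?_⟩
  exact (G.starSubgraph S).abuts_eq_some_of _ v hv hcv

/-- **A full star on a finite set of vertices of a locally finite semi-graph is finite.**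
[cite: MochizukiSemiAnbd2006, §1, p. 13] -/
theorem isFinite_starSubgraph (hG : G.IsLocallyFinite) (hS : S.Finite) :
    (G.starSubgraph S).toSemiGraph.IsFinite := by
  have hE : (G.starSubgraph S).edges.Finite := by
    refine (hS.biUnion fun v _ => hG.finite_edges v).subset ?_
    rintro e ⟨v, hv, he⟩
    exact Set.mem_biUnion hv he
  haveI : Finite (G.starSubgraph S).verts := hS.to_subtype
  haveI : Finite (G.starSubgraph S).edges := hE.to_subtype
  exact ⟨inferInstanceAs (Finite (G.starSubgraph S).verts),
    inferInstanceAs (Finite (G.starSubgraph S).edges)⟩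

/-- In the full star, a branch abuts to a vertex iff it abuts, in `G`, to a vertex of `S`; in
particular the verticial cardinality of an edge of the star is the number of its abutments inside `S`
(edges with one abutment in `S` and one outside become OPEN). [cite: MochizukiSemiAnbd2006, §1, p. 12] -/
theorem starSubgraph_abuts_isSome_iff (b : (G.starSubgraph S).toSemiGraph.Branch) :
    ((G.starSubgraph S).toSemiGraph.abuts b).isSome ↔ ∃ v ∈ S, G.abuts b.1 = some v :=
  (G.starSubgraph S).abuts_isSome_iff b

/-- The verticial portion of an edge of the full star corresponds to the branches of the edge abutting
INSIDE `S`. [cite: MochizukiSemiAnbd2006, §1, p. 11] -/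
theorem mem_verticialPortion_starSubgraph_iff (e : (G.starSubgraph S).toSemiGraph.Edge)
    (b : (G.starSubgraph S).toSemiGraph.Branch) :
    b ∈ (G.starSubgraph S).toSemiGraph.verticialPortion e ↔
      G.edgeOf b.1 = e.1 ∧ ∃ v ∈ S, G.abuts b.1 = some v := by
  change ((G.starSubgraph S).toSemiGraph.edgeOf b = e ∧ _) ↔ _
  rw [starSubgraph_abuts_isSome_iff]
  exact and_congr_left' ⟨fun h => congrArg Subtype.val h, fun h => Subtype.ext h⟩

/-- **An edge of `G` all of whose abutments lie in `S` keeps its verticial cardinality in the full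
star** — so a closed edge of `G` joining two vertices of `S` is a CLOSED edge of the star (the closed
edge `e₃` of the link of Prop 4.7). [cite: MochizukiSemiAnbd2006, §1, p. 12] -/
theorem vertCard_starSubgraph_eq (e : (G.starSubgraph S).toSemiGraph.Edge)
    (h : ∀ (b : G.Branch) (v : G.Vertex), G.edgeOf b = e.1 → G.abuts b = some v → v ∈ S) :
    (G.starSubgraph S).toSemiGraph.vertCard e = G.vertCard e.1 := by
  unfold vertCard
  refine Nat.card_congr
    { toFun := fun x => ⟨x.1.1, ?_⟩
      invFun := fun y => ⟨⟨y.1, by rw [y.2.1]; exact e.2⟩, ?_⟩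
      left_inv := fun x => Subtype.ext (Subtype.ext rfl)
      right_inv := fun y => Subtype.ext rfl }
  · -- a branch abutting inside `S` abuts
    obtain ⟨he, v, -, hv⟩ := (G.mem_verticialPortion_starSubgraph_iff S e x.1).mp x.2
    exact ⟨he, by rw [hv]; rfl⟩
  · -- a branch of `e` abutting in `G` abuts inside `S` by `h`
    obtain ⟨he, hsome⟩ := y.2
    obtain ⟨v, hv⟩ := Option.isSome_iff_exists.mp hsome
    exact (G.mem_verticialPortion_starSubgraph_iff S e _).mpr ⟨he, v, h y.1 v he hv, hv⟩

/-- **A closed edge of `G` all of whose abutments lie in `S` is a CLOSED edge of the full star** — the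
closed edge `e₃` of "the link contained in `𝒢₃` … determined by … `v₃`, `e₃`" when `S` contains both abutments
of `e₃`. [cite: MochizukiSemiAnbd2006, Def 4.2 (i), p. 52] -/
theorem isClosedEdge_starSubgraph_of (e : (G.starSubgraph S).toSemiGraph.Edge)
    (h : ∀ (b : G.Branch) (v : G.Vertex), G.edgeOf b = e.1 → G.abuts b = some v → v ∈ S)
    (he : G.IsClosedEdge e.1) : (G.starSubgraph S).toSemiGraph.IsClosedEdge e := by
  unfold IsClosedEdge
  rw [G.vertCard_starSubgraph_eq S e h]
  exact he

/-- **An edge of the full star with an abutment OUTSIDE `S` is OPEN** (verticial cardinality `< 2`): one of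
its two branches does not abut in the star.  (For the link of Prop 4.7 these are the further edges at
`v₃`, `v₃′`: open, and non-isolated since their other branch abuts inside `S`.)
[cite: MochizukiSemiAnbd2006, §1, p. 12] -/
theorem isOpenEdge_starSubgraph_of (e : (G.starSubgraph S).toSemiGraph.Edge) (b : G.Branch)
    (hb : G.edgeOf b = e.1) (hout : ∀ v ∈ S, G.abuts b ≠ some v) :
    (G.starSubgraph S).toSemiGraph.IsOpenEdge e := by
  classical
  -- the verticial portion misses the branch `b`, so it is a proper subset of the two branches of `e`
  unfold IsOpenEdge vertCard
  let b' : (G.starSubgraph S).toSemiGraph.Branch := ⟨b, by rw [hb]; exact e.2⟩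
  have hb' : b' ∉ (G.starSubgraph S).toSemiGraph.verticialPortion e := by
    intro hmem
    obtain ⟨-, v, hv, habut⟩ := (G.mem_verticialPortion_starSubgraph_iff S e b').mp hmem
    exact hout v hv habut
  -- the branches of `e` in the star are those of `e.1` in `G`: at most two
  obtain ⟨b₁, b₂, hne, h₁, h₂, hall⟩ := G.two_branches e.1
  have hsub : (G.starSubgraph S).toSemiGraph.verticialPortion e ⊆
      ({⟨b₁, by rw [h₁]; exact e.2⟩, ⟨b₂, by rw [h₂]; exact e.2⟩} :
        Finset (G.starSubgraph S).toSemiGraph.Branch) := by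
    intro x hx
    obtain ⟨hxe, -⟩ := (G.mem_verticialPortion_starSubgraph_iff S e x).mp hx
    simp only [Finset.coe_insert, Finset.coe_singleton, Set.mem_insert_iff, Set.mem_singleton_iff]
    rcases hall x.1 hxe with hx1 | hx2
    · exact Or.inl (Subtype.ext hx1)
    · exact Or.inr (Subtype.ext hx2)
  have hfin : ((G.starSubgraph S).toSemiGraph.verticialPortion e).Finite :=
    Set.Finite.subset (Finset.finite_toSet _) hsub
  rw [Nat.card_eq_card_finite_toFinset hfin]
  have hss : hfin.toFinset ⊂ ({⟨b₁, by rw [h₁]; exact e.2⟩, ⟨b₂, by rw [h₂]; exact e.2⟩} :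
      Finset (G.starSubgraph S).toSemiGraph.Branch) := by
    refine Finset.ssubset_iff_subset_ne.mpr ⟨fun x hx => hsub ((Set.Finite.mem_toFinset hfin).mp hx), ?_⟩
    intro heq
    apply hb'
    rw [← Set.Finite.mem_toFinset hfin, heq]
    rcases hall b hb with hb1 | hb2
    · exact Finset.mem_insert.mpr (Or.inl (Subtype.ext hb1))
    · exact Finset.mem_insert.mpr (Or.inr (Finset.mem_singleton.mpr (Subtype.ext hb2)))
  calc hfin.toFinset.card < Finset.card ({⟨b₁, by rw [h₁]; exact e.2⟩, ⟨b₂, by rw [h₂]; exact e.2⟩} :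
        Finset (G.starSubgraph S).toSemiGraph.Branch) := Finset.card_lt_card hss
    _ ≤ 2 := Finset.card_le_two

end SemiGraph

/-! ### 3. The carrier in the ambient category: `𝒳_{star(S)}` and its arrow to `X` -/

namespace SgAQuot

namespace SgA

open SemiGraphOfAnabelioids

variable (X : SgA.{v₁, u₁, u}) (S : Set X.toSgA.graph.Vertex)

/-- Every edge of the pull-back of `X` along the full-star inclusion abuts to a vertex.
[cite: MochizukiSemiAnbd2006, Rmk 2.4.2, p. 26] -/
theorem everyEdgeAbuts_inducedAlong_starSubgraph :
    (X.toSgA.inducedAlong (X.toSgA.graph.starSubgraph S).ι).EveryEdgeAbuts :=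
  fun e => X.toSgA.graph.starSubgraph_edgeAbuts S e

/-- **`X.starAt S`: the semi-graph of anabelioids of `X` pulled back along the full-star sub-semi-graph on
`S`, as an object of the ambient category `SgA`** (totally aloof and verticially slim by
`isAmbientObj_inducedAlong`, the inclusion being an immersion; every edge abuts).  For an untangled finite
étale covering `X = 𝔾₃ → 𝔾` and `S` the two abutments of a closed edge `e₃`, this is the underlying
semi-graph of anabelioids of "the link contained in `𝒢₃` … determined by … `v₃`, `e₃`" (Prop 4.7, proof p.57;
when `e₃` is the unique closed edge joining `v₃`, `v₃′`).
[cite: MochizukiSemiAnbd2006, Prop 4.7, p. 57] -/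
def starAt : SgA.{v₁, u₁, u} :=
  have h := isAmbientObj_inducedAlong X.toSgA (X.toSgA.graph.starSubgraph S).ι
    (X.toSgA.graph.starSubgraph_ι_isImmersion S) X.isTotallyAloof X.isVerticiallySlim
    (X.everyEdgeAbuts_inducedAlong_starSubgraph S)
  ofSgA (X.toSgA.inducedAlong (X.toSgA.graph.starSubgraph S).ι) h.1 h.2.1 h.2.2

/-- The underlying semi-graph of anabelioids of `X.starAt S` is the pull-back of `X` along the star
inclusion. [cite: MochizukiSemiAnbd2006, §4, p. 50] -/
@[simp] theorem starAt_toSgA :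
    (X.starAt S).toSgA = X.toSgA.inducedAlong (X.toSgA.graph.starSubgraph S).ι := rfl

/-- The underlying semi-graph of `X.starAt S` is the full-star sub-semi-graph.
[cite: MochizukiSemiAnbd2006, §1, p. 12] -/
theorem starAt_graph :
    (X.starAt S).toSgA.graph = (X.toSgA.graph.starSubgraph S).toSemiGraph := rfl

/-- **The natural arrow `X.starAt S ⟶ X`** of the ambient category (the class of the natural 1-morphism
`𝒳_{star(S)} → 𝒳` over the inclusion, identity constituent functors). [cite: MochizukiSemiAnbd2006, §4, p. 50] -/
def starAtHom : X.starAt S ⟶ X :=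
  homOfHom (X := X.starAt S) (Y := X) (X.toSgA.inducedAlongHom (X.toSgA.graph.starSubgraph S).ι)
    (X.toSgA.inducedAlongHom_isLocallyOpen _)

/-- The underlying `SgAQuot`-arrow of `starAtHom`. [cite: MochizukiSemiAnbd2006, §4, p. 50] -/
@[simp] theorem starAtHom_hom_hom :
    (X.starAtHom S).hom.hom = SgAQuot.homOf (X.toSgA.inducedAlongHom (X.toSgA.graph.starSubgraph S).ι) :=
  rfl

/-- `starAtHom` lies over the inclusion of the full-star sub-semi-graph. [cite: MochizukiSemiAnbd2006, §1, p. 12] -/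
theorem starAtHom_base : (X.starAtHom S).hom.hom.base = (X.toSgA.graph.starSubgraph S).ι := rfl

/-- **`starAtHom` is locally trivial** (identity constituents). [cite: MochizukiSemiAnbd2006, Def 2.2 (ii), p. 24] -/
theorem locallyTrivial_starAtHom : locallyTrivial (X.starAtHom S).hom.hom :=
  (homOf_mem_locallyTrivial_iff _).mpr (X.toSgA.inducedAlongHom_isLocallyTrivial _)

/-- `starAtHom` is locally finite étale. [cite: MochizukiSemiAnbd2006, Def 2.2 (ii), p. 24] -/
theorem locallyFiniteEtale_starAtHom : locallyFiniteEtale (X.starAtHom S).hom.hom :=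
  locallyFiniteEtale_of_locallyTrivial (X.locallyTrivial_starAtHom S)

/-- **`starAtHom` lies over an EXCISION of semi-graphs** — so `X.starAt S → X` is an excision in the
sense of Def 4.1 (ii) once read through the container dictionary (`ofReal_isGraphExcision_iff`).
[cite: MochizukiSemiAnbd2006, Def 4.1 (ii), p. 50] -/
theorem isExcision_starAtHom_base : SemiGraph.IsExcision (X.starAtHom S).hom.hom.base :=
  X.toSgA.graph.starSubgraph_ι_isExcision S

/-- `starAtHom` lies over an immersion of semi-graphs. [cite: MochizukiSemiAnbd2006, Def 4.1 (ii), p. 50] -/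
theorem isImmersion_starAtHom_base : SemiGraph.IsImmersion (X.starAtHom S).hom.hom.base :=
  X.toSgA.graph.starSubgraph_ι_isImmersion S

/-- `X.starAt S` is of injective type when `X` is (pull-back along an immersion,
`inducedAlong_isOfInjectiveType`). [cite: MochizukiSemiAnbd2006, Def. 2.1 p.22] -/
theorem starAt_isOfInjectiveType (hX : X.toSgA.IsOfInjectiveType) : (X.starAt S).toSgA.IsOfInjectiveType :=
  X.toSgA.inducedAlong_isOfInjectiveType _ hX

/-- `X.starAt S` is totally estranged when `X` is. [cite: MochizukiSemiAnbd2006, Def 2.4 (iv), p. 26] -/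
theorem starAt_isTotallyEstranged (hX : X.toSgA.IsTotallyEstranged) :
    (X.starAt S).toSgA.IsTotallyEstranged :=
  X.toSgA.inducedAlong_isTotallyEstranged _ (X.toSgA.graph.starSubgraph_ι_isImmersion S) hX

/-- The underlying semi-graph of `X.starAt S` is finite when `S` is finite and `X` locally finite.
[cite: MochizukiSemiAnbd2006, §1, p. 13] -/
theorem starAt_isFinite (hX : X.toSgA.graph.IsLocallyFinite) (hS : S.Finite) :
    (X.starAt S).toSgA.graph.IsFinite :=
  X.toSgA.graph.isFinite_starSubgraph S hX hS

end SgA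

end SgAQuot

end Literature.AnabelianGeometry.SemiGraphs

end
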